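import Summits.HodgeConjecture.HodgeConjecture.Theorems.F0P3cStCharTSHyperbolicSetEigen   -- ★ p850110 (F0P2-p02 (g15)) «HYP-EIG★»: `mul_conjLocal_eq_one_of_not_mem_hyperbolicSet` (brings ★ TorusDefs `hyperbolicSet`, ★ (E1) EllipticCriterion, ★ WeylHypFibre)
import Literature.NumberTheory.Rogawski1990.LocalEndoscopicChartDatumCM                  -- ★ `isOpen_setOf_isRegularElt_cmDatum_local` (the regular locus of `U(H)(L⁺_v)` is open)
import Literature.NumberTheory.Rogawski1990.Ch12Sec5Defs                                -- ★ `Ch12Sec5.EllipticData` (the (S-𝔇) datum vocabulary, head (b))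
import Literature.NumberTheory.Automorphic.AdicCompletionCompact                         -- ★ `properSpace_adicCompletion` (`L_w` is a proper metric space)
import Summits.HodgeConjecture.HodgeConjecture.Theorems.F0P3cStCharTSRootCalculus      -- ★-cand (this seat) «ROOT-CALCULUS★»: the field-level CORE LEMMA `eq_of_roots_of_map_mul_eq_one`; brings ★ `continuous_charpoly_coeff`
import HarnessLib

/-!
# F0 · P3c · line LH6 «StCharTS» — «ELL-OPEN★»: THE ELLIPTIC-REGULAR SET `G^e = G^r ∖ Ω ⊆ U(Φ₃)(L⁺_v)` IS OPEN at a non-split place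
# (datum road MAP-DATUM-ROAD v1∕v2, slice S8 part 1; the `hopen` input of ★ «LDS-OPP★» `F0P3cStCharTSLdsOpp.ldsCharactersOpposite_Gqs`)

Cell `pub/hodgecm-mathlib`, crux H413 = `stmt-HodgeConjecture-24833` (lane `--supports … --as helper`), route HCCMUnconditional; seat F0P2-p06 (g17),
self-dealt per MAP-DATUM-ROAD v1 c27052c38efdd9c4 §1 («free slices for a fourth hand: S8 first»), map owner LH6-p01 (g4) «=» 2026-09-02T11:17:16Z.
THEOREMS ONLY (no definition ∕ instance ∕ notation ∕ named fact ∕ `sorry`); imports ★ modules + Mathlib.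

WHAT.  `Ω = hyperbolicSet L v` (★ TorusDefs) is the set of conjugates of the regular elements of the diagonal torus `M ≅ E^× × E¹` of `G = U(Φ₃)(L⁺_v)`, and
`G^e := G^r ∖ Ω` is print's elliptic-regular set [Rogawski1990, §12.5 p. 184].  We prove that `G^e` is OPEN at a non-split `v`
(`isOpen_setOf_isRegularElt_and_not_mem_hyperbolicSet`), in the `↔`-hypothesis form of the datum road as well (`isOpen_ellG`), so that test functions
can be localised inside `G^e` — the hypothesis `hopen` of LH6-p01 (g4)'s ★ «LDS-OPP★» (the carpet `Ch12Sec6.LdsCharactersOpposite`, §12.6 p. 188) and of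
every «density on `G^e`» step of §12.5–12.7.

HOW (eigenvalues only — no `p`-adic manifolds, no Krasner, no Hensel).  By ★ «HYP-EIG★» `mem_hyperbolicSet_iff` (F0P2-p02 (g15)) a regular `γ` lies in
`Ω` iff its characteristic polynomial has a root `α ∈ L ⊗ L⁺_v = L_w` with `α σ(α) ≠ 1`; more precisely (★ (E1) + the torus relations) a member of `Ω`
has TWO DISTINCT rational eigenvalues `α ≠ β` with `σ(α) β = 1` (`exists_roots_of_mem_hyperbolicSet`), while at a regular `γ₀ ∉ Ω` every rational
eigenvalue `a` has `a σ(a) = 1`.  The CORE LEMMA `eq_of_roots_of_map_mul_eq_one` (§4) is pure root calculus over the proper normed field `K = L_w`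
(★ `properSpace_adicCompletion`): for a monic separable `p₀` all of whose `K`-roots lie on `{a σ(a) = 1}` there is `ε > 0` such that no monic `p` of the
same degree with coefficients within `ε` has two distinct `K`-roots `α ≠ β` with `σ(α) β = 1` — because (§2, Cauchy bound + compactness of closed balls:
the `K`-root-free factor of `p₀` is bounded below on a ball) every `K`-root of `p` is near a `K`-root `a` of `p₀`, so `β = σ(α)⁻¹` is near `σ(a)⁻¹ = a`
too, and (§3, the divided difference `p(y) − p(x) = D(p; x, y)(y − x)` of ★ `CharpolyLocalRigidity`, `D(p₀; a, a) = p₀′(a) ≠ 0`) two roots of `p`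
near the SIMPLE root `a` coincide.  §5 transports along the one-place model `L ⊗ L⁺_v ≃+* L_w` (non-split) and the coefficient continuity
★ `continuous_charpoly_coeff`; the regular locus is open by ★ `isOpen_setOf_isRegularElt_cmDatum_local`.
HONEST LABEL: HC_CM is proved only modulo the 7 printed citations (2 remaining named inputs: hLiu418 = `stmt-HodgeConjecture-24832`, h413 =
`stmt-HodgeConjecture-24833`) until rung 0 closes; this file closes no organ (count-neutral datum-road brick).

## References
* [Rogawski1990] J. D. Rogawski, *Automorphic Representations of Unitary Groups in Three Variables*, Ann. of Math. Stud. 123 (1990): §3.1 p. 19 (regular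
  elements), §3.6 pp. 29–31 (Cartan subgroups of `U(3)`), §12.5 pp. 182–184 (`G^r`, `G^e`, the split torus), §12.6 p. 188.
* [HarishChandra1970] Harish-Chandra (notes by G. van Dijk), *Harmonic Analysis on Reductive p-adic Groups*, LNM 162 (1970), Part I §3 (the regular set and
  its decomposition by Cartan subgroups is open).
-/

set_option autoImplicit false
-- the mandated namespace has the single-problem summit's repeated segment (`HodgeConjecture.HodgeConjecture`)
set_option linter.dupNamespace false

noncomputable section

open NumberField IsDedekindDomain Polynomial Filter Topology Metric
open scoped Matrix MatrixGroups
open Literature.NumberTheory.Rogawski1990 Literature.NumberTheory.Automorphic Literature.NumberTheory.Automorphic.UnitaryGroup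
open Literature.NumberTheory.Rogawski1990.Ch12Sec5
open Summit.HodgeConjecture.HodgeConjecture.Cruxes.H413.F0P3cStCharTSTorusDefs
open Summit.HodgeConjecture.HodgeConjecture.Cruxes.H413.F0P3cStCharTSHyperbolicSet
open Summit.HodgeConjecture.HodgeConjecture.Cruxes.H413.F0P3cStCharTSHyperbolicSetEigen

open Summit.HodgeConjecture.HodgeConjecture.Cruxes.H413.F0P3cStCharTSRootCalculus

namespace Summit.HodgeConjecture.HodgeConjecture.Cruxes.H413.F0P3cStCharTSEllOpen

/-! ## §5 `U(Φ₃)(L⁺_v)`: members of `Ω` have two distinct rational eigenvalues `α ≠ β` with `σ(α) β = 1` -/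

section Gqs

variable (L : Type) [Field L] [NumberField L] [IsCMField L] (v : HeightOneSpectrum (𝓞 ↥(maximalRealSubfield L)))

set_option maxHeartbeats 1600000 in  -- statement-level `whnf` on the CM carriers (as in ★ «HYP-EIG★»)
/-- **A member of `Ω` has TWO DISTINCT eigenvalues `α ≠ β` in `L ⊗ L⁺_v` with `σ(α) β = 1`** (any place): `γ` is conjugate to a regular
`t = d(d₀, d₁, d₂) ∈ M`, so `charpoly γ = ∏ᵢ (X − dᵢ)`; the torus relations of `Φ₃` give `σ(d₀) d₂ = 1` (★ (E1) `torus_relations_of_glDiagonal_eq`)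
and regularity gives `d₀ − d₂ ∈ Rˣ` (★ `isUnit_sub_of_isRegularElt_glDiagonal`). [cite: Rogawski1990, §12.5 p. 182; §1.10 p. 9; §3.1 p. 19] -/
theorem exists_roots_of_mem_hyperbolicSet {γ : Gqs L v} (hγ : γ ∈ hyperbolicSet L v) :
    ∃ α β : UnitaryGroup.LocalRing L v,
      (γ.val.val : Matrix (Fin 3) (Fin 3) (UnitaryGroup.LocalRing L v)).charpoly.IsRoot α ∧
      (γ.val.val : Matrix (Fin 3) (Fin 3) (UnitaryGroup.LocalRing L v)).charpoly.IsRoot β ∧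
      α ≠ β ∧ conjLocal L (IsCMField.complexConj L) v α * β = 1 := by
  obtain ⟨t, ht, hc⟩ := hγ
  obtain ⟨x, hx⟩ := isConj_iff.1 hc
  -- `charpoly γ = charpoly t`
  have e : (γ.val.val : Matrix (Fin 3) (Fin 3) (UnitaryGroup.LocalRing L v)).charpoly =
      ((t : ↥(unitaryGroupOfForm (conjLocal L (IsCMField.complexConj L) v) (cmLocalForm L 3 v))).val.val :
        Matrix (Fin 3) (Fin 3) (UnitaryGroup.LocalRing L v)).charpoly := by
    rw [← hx, Subgroup.coe_mul, Subgroup.coe_mul, InvMemClass.coe_inv, Units.val_mul, Units.val_mul, Matrix.coe_units_inv, Matrix.charpoly_units_conj]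
  -- `t = diag(d)` with the torus relations of `Φ₃`
  obtain ⟨d, hd⟩ := (mem_torusU_iff (t : ↥(unitaryGroupOfForm (conjLocal L (IsCMField.complexConj L) v) (cmLocalForm L 3 v)))).1 t.2
  obtain ⟨-, -, h02⟩ := F0P3cStCharTSEllipticCriterion.torus_relations_of_glDiagonal_eq (conjLocal L (IsCMField.complexConj L) v)
    (cmLocalForm_eq_over L 3 v) hd
  -- a regular diagonal element has `d₀ − d₂ ∈ Rˣ`
  have hreg' : IsRegularElt (glDiagonal 3 (UnitaryGroup.LocalRing L v) d) := by rw [hd]; exact ht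
  have hu := F0P3cStCharTSWeylHypFibre.isUnit_sub_of_isRegularElt_glDiagonal (i := 0) (j := 2) hreg' (by decide)
  have hcp : ((t : ↥(unitaryGroupOfForm (conjLocal L (IsCMField.complexConj L) v) (cmLocalForm L 3 v))).val.val :
        Matrix (Fin 3) (Fin 3) (UnitaryGroup.LocalRing L v)).charpoly = ∏ i : Fin 3, (X - C (d i : UnitaryGroup.LocalRing L v)) := by
    rw [← hd, coe_glDiagonal, Matrix.charpoly_diagonal]
  refine ⟨d 0, d 2, ?_, ?_, fun h => ?_, h02⟩
  · rw [e, hcp, IsRoot.def, eval_prod]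
    exact Finset.prod_eq_zero (Finset.mem_univ (0 : Fin 3)) (by simp)
  · rw [e, hcp, IsRoot.def, eval_prod]
    exact Finset.prod_eq_zero (Finset.mem_univ (2 : Fin 3)) (by simp)
  · rw [h, sub_self] at hu
    exact not_isUnit_zero hu

/-! ## §6 The one-place model `L ⊗ L⁺_v → L_w` (evaluation at the unique place above a non-split `v`) -/

/-- Roots of a mapped polynomial along an INJECTIVE ring map: `(p.map f)(f x) = 0 ↔ p(x) = 0`. [folklore] -/
theorem isRoot_map_iff_of_injective {R S : Type*} [CommRing R] [CommRing S] (f : R →+* S) (hf : Function.Injective f) (p : R[X]) (x : R) :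
    (p.map f).IsRoot (f x) ↔ p.IsRoot x := by
  rw [IsRoot.def, IsRoot.def, eval_map, eval₂_at_apply, map_eq_zero_iff f hf]

/-- At a non-split `v` the evaluation `L ⊗ L⁺_v = ∏_{w′ ∣ v} L_{w′} → L_w` at the unique place `w ∣ v` is INJECTIVE.
[cite: PlatonovRapinchuk1994, §5.1] [cite: Rogawski1990, §3.1 p. 19] -/
theorem evalPlace_injective (w : PlacesOver L v) (hw : IsCMField.complexConj L • w.1 = w.1) :
    Function.Injective (Pi.evalRingHom (fun w' : PlacesOver L v => w'.1.adicCompletion L) w) := by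
  haveI : Algebra.IsQuadraticExtension ↥(maximalRealSubfield L) L := IsCMField.isQuadraticExtension L
  haveI := PlacesOver.subsingleton_of_smul_eq (IsCMField.complexConj L) (IsCMField.complexConj_ne_one L) w hw
  intro x y h
  funext w'
  obtain rfl : w' = w := Subsingleton.elim w' w
  exact h

/-- … and SURJECTIVE. [cite: PlatonovRapinchuk1994, §5.1] [cite: Rogawski1990, §3.1 p. 19] -/
theorem evalPlace_surjective (w : PlacesOver L v) (hw : IsCMField.complexConj L • w.1 = w.1) :
    Function.Surjective (Pi.evalRingHom (fun w' : PlacesOver L v => w'.1.adicCompletion L) w) := by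
  haveI : Algebra.IsQuadraticExtension ↥(maximalRealSubfield L) L := IsCMField.isQuadraticExtension L
  letI : Unique (PlacesOver L v) :=
    @uniqueOfSubsingleton _ (PlacesOver.subsingleton_of_smul_eq (IsCMField.complexConj L) (IsCMField.complexConj_ne_one L) w hw) w
  intro a
  exact ⟨(RingEquiv.piUnique fun w' : PlacesOver L v => w'.1.adicCompletion L).symm a,
    (RingEquiv.piUnique fun w' : PlacesOver L v => w'.1.adicCompletion L).apply_symm_apply a⟩

/-- The evaluation intertwines the conjugation `c ⊗ 1` of `L ⊗ L⁺_v` with `σ_w` on `L_w` (★ `conjLocal_apply_eq_of_smul_eq`).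
[cite: CasselsFrohlichANT1967, Ch. VII §1.1] [cite: PlatonovRapinchuk1994, §5.1] -/
theorem evalPlace_conjLocal (w : PlacesOver L v) (hw : IsCMField.complexConj L • w.1 = w.1) (x : UnitaryGroup.LocalRing L v) :
    Pi.evalRingHom (fun w' : PlacesOver L v => w'.1.adicCompletion L) w (conjLocal L (IsCMField.complexConj L) v x) =
      galAdicCompletionMap (L := L) (IsCMField.complexConj L) hw (Pi.evalRingHom (fun w' : PlacesOver L v => w'.1.adicCompletion L) w x) := by
  haveI : Algebra.IsQuadraticExtension ↥(maximalRealSubfield L) L := IsCMField.isQuadraticExtension L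
  exact UnitaryGroup.conjLocal_apply_eq_of_smul_eq (IsCMField.complexConj L) (IsCMField.complexConj_ne_one L) v w hw x

/-- The coefficients of the characteristic polynomial READ AT `w` depend continuously on `γ ∈ U(Φ₃)(L⁺_v)` (★ `continuous_charpoly_coeff`).
[cite: Borel1991, IV.12.3] [cite: Rogawski1990, §3.1 p. 19] -/
theorem continuous_evalPlace_charpoly_coeff (w : PlacesOver L v) (i : ℕ) :
    Continuous fun γ : Gqs L v =>
      Pi.evalRingHom (fun w' : PlacesOver L v => w'.1.adicCompletion L) w
        (((γ.val.val : Matrix (Fin 3) (Fin 3) (UnitaryGroup.LocalRing L v)).charpoly).coeff i) := by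
  have h1 : Continuous fun x : UnitaryGroup.LocalRing L v => x w := continuous_apply w
  have h2 : Continuous fun γ : Gqs L v => (γ.val.val : Matrix (Fin 3) (Fin 3) (UnitaryGroup.LocalRing L v)) :=
    Units.continuous_val.comp continuous_subtype_val
  exact h1.comp ((Literature.LinearAlgebra.Matrix.continuous_charpoly_coeff i).comp h2)

set_option maxHeartbeats 1600000 in  -- statement-level `whnf` on the CM carriers
/-- **At a regular `γ₀ ∉ Ω` every `L_w`-rational eigenvalue lies on the norm-one torus `{a σ(a) = 1}`** (★ «HYP-EIG★»
`mul_conjLocal_eq_one_of_not_mem_hyperbolicSet`, read at `w`). [cite: Rogawski1990, §12.5 p. 182; §3.6] -/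
theorem mul_galAdicCompletionMap_eq_one_of_isRoot_map (hns : ∀ w : PlacesOver L v, IsCMField.complexConj L • w.1 = w.1) (w : PlacesOver L v)
    {γ₀ : Gqs L v} (hreg : IsRegularElt (γ₀.val : GL (Fin 3) (UnitaryGroup.LocalRing L v))) (hnot : γ₀ ∉ hyperbolicSet L v)
    {a : w.1.adicCompletion L}
    (ha : (((γ₀.val.val : Matrix (Fin 3) (Fin 3) (UnitaryGroup.LocalRing L v)).charpoly).map
      (Pi.evalRingHom (fun w' : PlacesOver L v => w'.1.adicCompletion L) w)).IsRoot a) :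
    a * galAdicCompletionMap (L := L) (IsCMField.complexConj L) (hns w) a = 1 := by
  obtain ⟨x, rfl⟩ := evalPlace_surjective L v w (hns w) a
  rw [isRoot_map_iff_of_injective _ (evalPlace_injective L v w (hns w))] at ha
  have h1 := congrArg (Pi.evalRingHom (fun w' : PlacesOver L v => w'.1.adicCompletion L) w)
    (mul_conjLocal_eq_one_of_not_mem_hyperbolicSet L v hns hreg hnot ha)
  rwa [map_mul, map_one, evalPlace_conjLocal L v w (hns w)] at h1

set_option maxHeartbeats 1600000 in  -- statement-level `whnf` on the CM carriers
/-- **A member of `Ω`, read at `w`: two DISTINCT roots `a ≠ b` of the characteristic polynomial in `L_w` with `σ_w(a) b = 1`**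
(`exists_roots_of_mem_hyperbolicSet` pushed along the injective evaluation). [cite: Rogawski1990, §12.5 p. 182; §1.10 p. 9] -/
theorem exists_roots_map_of_mem_hyperbolicSet (hns : ∀ w : PlacesOver L v, IsCMField.complexConj L • w.1 = w.1) (w : PlacesOver L v)
    {γ : Gqs L v} (hγ : γ ∈ hyperbolicSet L v) :
    ∃ a b : w.1.adicCompletion L,
      (((γ.val.val : Matrix (Fin 3) (Fin 3) (UnitaryGroup.LocalRing L v)).charpoly).map
        (Pi.evalRingHom (fun w' : PlacesOver L v => w'.1.adicCompletion L) w)).IsRoot a ∧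
      (((γ.val.val : Matrix (Fin 3) (Fin 3) (UnitaryGroup.LocalRing L v)).charpoly).map
        (Pi.evalRingHom (fun w' : PlacesOver L v => w'.1.adicCompletion L) w)).IsRoot b ∧
      a ≠ b ∧ galAdicCompletionMap (L := L) (IsCMField.complexConj L) (hns w) a * b = 1 := by
  obtain ⟨α, β, hα, hβ, hne, hαβ⟩ := exists_roots_of_mem_hyperbolicSet L v hγ
  have hinj := evalPlace_injective L v w (hns w)
  refine ⟨_, _, (isRoot_map_iff_of_injective _ hinj _ α).2 hα, (isRoot_map_iff_of_injective _ hinj _ β).2 hβ, fun h => hne (hinj h), ?_⟩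
  rw [← evalPlace_conjLocal L v w (hns w), ← map_mul, hαβ, map_one]

/-! ## §7 «ELL-OPEN★»: `G^e = G^r ∖ Ω` is open -/

set_option maxHeartbeats 1600000 in  -- statement-level `whnf` on the CM carriers
/-- **«ELL-OPEN★»: THE ELLIPTIC-REGULAR SET `G^e = G^r ∖ Ω = {γ regular, γ ∉ hyperbolicSet}` IS OPEN in `U(Φ₃)(L⁺_v)`** at a NON-SPLIT place `v` — the
hypothesis `hopen` of ★ «LDS-OPP★» `F0P3cStCharTSLdsOpp.ldsCharactersOpposite_Gqs`, token for token.  Proof: read the characteristic polynomial in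
the one-place model `L_w` (a proper normed field, ★ `properSpace_adicCompletion`); at a regular `γ₀ ∉ Ω` every rational eigenvalue lies on `{a σ(a) = 1}`
(`mul_galAdicCompletionMap_eq_one_of_isRoot_map`), so the CORE LEMMA `eq_of_roots_of_map_mul_eq_one` forbids, for `γ` with nearby characteristic
polynomial (`continuous_evalPlace_charpoly_coeff`), the two distinct eigenvalues `a ≠ b`, `σ(a) b = 1` that a member of `Ω` must have
(`exists_roots_map_of_mem_hyperbolicSet`); regularity is open (★ `isOpen_setOf_isRegularElt_cmDatum_local`).
[cite: Rogawski1990, §12.5 pp. 182–184; §3.6] [cite: HarishChandra1970, Part I §3] -/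
theorem isOpen_setOf_isRegularElt_and_not_mem_hyperbolicSet (hns : ∀ w : PlacesOver L v, IsCMField.complexConj L • w.1 = w.1) :
    IsOpen {γ : Gqs L v | IsRegularElt (γ.val : GL (Fin 3) (UnitaryGroup.LocalRing L v)) ∧ γ ∉ hyperbolicSet L v} := by
  haveI : Algebra.IsQuadraticExtension ↥(maximalRealSubfield L) L := IsCMField.isQuadraticExtension L
  obtain ⟨w⟩ := (inferInstance : Nonempty (PlacesOver L v))
  haveI : ProperSpace (w.1.adicCompletion L) := properSpace_adicCompletion L w.1
  rw [isOpen_iff_mem_nhds]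
  rintro γ₀ ⟨hreg₀, hnot₀⟩
  -- the CORE LEMMA at `p₀ = charpoly γ₀` read at `w`
  obtain ⟨ε, hε, hcore⟩ := eq_of_roots_of_map_mul_eq_one (galAdicCompletionMap (L := L) (IsCMField.complexConj L) (hns w))
    (continuous_galAdicCompletionMap (L := L) (IsCMField.complexConj L) (hns w)) ((Matrix.charpoly_monic _).map _)
    (((isRegularElt_iff _).1 hreg₀).map) (fun a ha => mul_galAdicCompletionMap_eq_one_of_isRoot_map L v hns w hreg₀ hnot₀ ha)
  -- the neighbourhood: regular, and the coefficients of degree `< 3` within `ε`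
  have hU : {γ : Gqs L v | IsRegularElt (γ.val : GL (Fin 3) (UnitaryGroup.LocalRing L v))} ∩
      (⋂ i ∈ Finset.range 3, {γ : Gqs L v |
        ‖Pi.evalRingHom (fun w' : PlacesOver L v => w'.1.adicCompletion L) w
            (((γ.val.val : Matrix (Fin 3) (Fin 3) (UnitaryGroup.LocalRing L v)).charpoly).coeff i) -
          Pi.evalRingHom (fun w' : PlacesOver L v => w'.1.adicCompletion L) w
            (((γ₀.val.val : Matrix (Fin 3) (Fin 3) (UnitaryGroup.LocalRing L v)).charpoly).coeff i)‖ < ε}) ∈ 𝓝 γ₀ := by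
    refine Filter.inter_mem ((isOpen_setOf_isRegularElt_cmDatum_local L (qsForm L) w (hns w)).mem_nhds hreg₀) ?_
    refine (isOpen_biInter_finset fun i _ => ?_).mem_nhds ?_
    · exact isOpen_lt ((continuous_evalPlace_charpoly_coeff L v w i).sub continuous_const).norm continuous_const
    · simp only [Set.mem_iInter, Set.mem_setOf_eq, sub_self, norm_zero]
      exact fun _ _ => hε
  refine Filter.mem_of_superset hU ?_
  rintro γ ⟨hreg, hcoeff⟩
  simp only [Set.mem_iInter, Set.mem_setOf_eq] at hreg hcoeff
  refine ⟨hreg, fun hΩ => ?_⟩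
  -- a member of `Ω` nearby would carry two distinct eigenvalues `a ≠ b`, `σ(a) b = 1`
  obtain ⟨a, b, ha, hb, hne, hab⟩ := exists_roots_map_of_mem_hyperbolicSet L v hns w hΩ
  refine hne (hcore _ ((Matrix.charpoly_monic _).map _) ?_ (fun i => ?_) a b ha hb hab)
  · rw [(Matrix.charpoly_monic _).natDegree_map, (Matrix.charpoly_monic _).natDegree_map, Matrix.charpoly_natDegree_eq_dim,
      Matrix.charpoly_natDegree_eq_dim]
  · rw [coeff_map, coeff_map]
    by_cases hi : i < 3
    · exact hcoeff i (Finset.mem_range.2 hi)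
    · -- both monic of degree `3`: the coefficients agree from degree `3` on
      have h3 : ((γ.val.val : Matrix (Fin 3) (Fin 3) (UnitaryGroup.LocalRing L v)).charpoly).coeff i =
          ((γ₀.val.val : Matrix (Fin 3) (Fin 3) (UnitaryGroup.LocalRing L v)).charpoly).coeff i := by
        have hdeg : ∀ M : Matrix (Fin 3) (Fin 3) (UnitaryGroup.LocalRing L v), M.charpoly.natDegree = 3 := fun M => by
          rw [Matrix.charpoly_natDegree_eq_dim, Fintype.card_fin]
        rcases Nat.lt_or_ge 3 i with hlt | hle
        · rw [coeff_eq_zero_of_natDegree_lt (by rw [hdeg]; exact hlt), coeff_eq_zero_of_natDegree_lt (by rw [hdeg]; exact hlt)]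
        · have hi3 : i = 3 := by omega
          subst hi3
          have e1 := (Matrix.charpoly_monic (γ.val.val : Matrix (Fin 3) (Fin 3) (UnitaryGroup.LocalRing L v))).coeff_natDegree
          have e2 := (Matrix.charpoly_monic (γ₀.val.val : Matrix (Fin 3) (Fin 3) (UnitaryGroup.LocalRing L v))).coeff_natDegree
          rw [hdeg] at e1 e2
          rw [e1, e2]
      rw [h3, sub_self, norm_zero]; exact hε

/-- **Filter form**: near a point of `G^e` every element is regular and outside `Ω` (non-split `v`). [cite: Rogawski1990, §12.5 pp. 182–184] -/
theorem eventually_isRegularElt_and_not_mem_hyperbolicSet (hns : ∀ w : PlacesOver L v, IsCMField.complexConj L • w.1 = w.1) {γ₀ : Gqs L v}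
    (hreg : IsRegularElt (γ₀.val : GL (Fin 3) (UnitaryGroup.LocalRing L v))) (hnot : γ₀ ∉ hyperbolicSet L v) :
    ∀ᶠ γ in 𝓝 γ₀, IsRegularElt (γ.val : GL (Fin 3) (UnitaryGroup.LocalRing L v)) ∧ γ ∉ hyperbolicSet L v :=
  (isOpen_setOf_isRegularElt_and_not_mem_hyperbolicSet L v hns).mem_nhds ⟨hreg, hnot⟩

/-- **Complement form**: `{γ | γ not regular ∨ γ ∈ Ω}` is CLOSED (non-split `v`); i.e. `Ω ∩ G^r = Ω` is relatively closed in the (open) regular set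
`G^r`, so `G^r = Ω ⊔ G^e` is a decomposition into two open sets. [cite: Rogawski1990, §12.5 pp. 182–184] -/
theorem isClosed_setOf_not_isRegularElt_or_mem_hyperbolicSet (hns : ∀ w : PlacesOver L v, IsCMField.complexConj L • w.1 = w.1) :
    IsClosed {γ : Gqs L v | ¬ IsRegularElt (γ.val : GL (Fin 3) (UnitaryGroup.LocalRing L v)) ∨ γ ∈ hyperbolicSet L v} := by
  rw [← isOpen_compl_iff]
  convert isOpen_setOf_isRegularElt_and_not_mem_hyperbolicSet L v hns using 1
  ext γ
  simp only [Set.mem_compl_iff, Set.mem_setOf_eq, not_or, not_not]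

/-! ## §8 The datum-road form (rule §2.1 of MAP-DATUM-ROAD: an `↔`-hypothesis on an abstract `𝔇`) -/

section Datum

variable [MeasurableSpace (Gqs L v)]
  [∀ γ : Gqs L v, MeasurableSpace (Gqs L v ⧸ Subgroup.centralizer ({γ} : Set (Gqs L v)))]
  [MeasurableSpace (Gqs L v ⧸ Subgroup.center (Gqs L v))]
  {H' : Type} [Group H'] [TopologicalSpace H'] [IsTopologicalGroup H'] [MeasurableSpace H']

/-- **`G^e` IS OPEN at every §12.5 datum `𝔇` on `U(Φ₃)(L⁺_v)` whose `ellG` is «regular and not in `Ω`»** (non-split `v`) — the `↔`-hypothesis `hE` of ★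
«ELL-FIELD★» ∕ ★ «LDS-OPP★», discharged by `Iff.rfl` at the concrete datum. [cite: Rogawski1990, §12.5 pp. 182–184] -/
theorem isOpen_ellG (hns : ∀ w : PlacesOver L v, IsCMField.complexConj L • w.1 = w.1) (𝔇 : EllipticData (Gqs L v) H')
    (hE : ∀ γ : Gqs L v, γ ∈ 𝔇.ellG ↔ IsRegularElt (γ.val : GL (Fin 3) (UnitaryGroup.LocalRing L v)) ∧ γ ∉ hyperbolicSet L v) :
    IsOpen 𝔇.ellG := by
  have h : 𝔇.ellG = {γ : Gqs L v | IsRegularElt (γ.val : GL (Fin 3) (UnitaryGroup.LocalRing L v)) ∧ γ ∉ hyperbolicSet L v} :=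
    Set.ext fun γ => hE γ
  rw [h]
  exact isOpen_setOf_isRegularElt_and_not_mem_hyperbolicSet L v hns

/-- **Localisation inside `G^e`**: every `γ ∈ 𝔇.ellG` has `𝔇.ellG` as a neighbourhood (non-split `v`; filter form of `isOpen_ellG`), so a test
function can be supported in `G^e` around `γ`. [cite: Rogawski1990, §12.5 pp. 182–184; §12.6 p. 188] -/
theorem ellG_mem_nhds (hns : ∀ w : PlacesOver L v, IsCMField.complexConj L • w.1 = w.1) (𝔇 : EllipticData (Gqs L v) H')
    (hE : ∀ γ : Gqs L v, γ ∈ 𝔇.ellG ↔ IsRegularElt (γ.val : GL (Fin 3) (UnitaryGroup.LocalRing L v)) ∧ γ ∉ hyperbolicSet L v)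
    {γ : Gqs L v} (hγ : γ ∈ 𝔇.ellG) : 𝔇.ellG ∈ 𝓝 γ :=
  (isOpen_ellG L v hns 𝔇 hE).mem_nhds hγ

end Datum

end Gqs

end Summit.HodgeConjecture.HodgeConjecture.Cruxes.H413.F0P3cStCharTSEllOpen

end
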